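import Literature.Topology.FourManifolds.Gluing
import Literature.Topology.FourManifolds.ClosedBall
import HarnessLib

/-!
# Twisted spheres `Σ(φ) = Dⁿ⁺¹ ∪_φ Dⁿ⁺¹`

Trunk T-4MAN (Literature/Topology/FourManifolds); definition request `defn-twistedSphere`
(route SmoothPoincare4/SchoenfliesSplit; consumers: Cerf `Γ₄ = 0`, R2 assembly, `Θ₄` statements).

A **twisted sphere** (Milnor; Kervaire–Milnor 1963, §1) is a closed smooth `(n+1)`-manifold
obtained by gluing two closed discs `Dⁿ⁺¹` along a diffeomorphism `φ : 𝕊ⁿ ≅ 𝕊ⁿ` of their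
boundaries, `Σ(φ) = Dⁿ⁺¹ ∪_φ Dⁿ⁺¹`. It is a homotopy sphere; `Σ(id) = 𝕊ⁿ⁺¹`; `Σ(φ)` depends up
to diffeomorphism only on the (pseudo-)isotopy class of `φ`, and `φ ↦ Σ(φ)` induces
`π₀ Diff⁺(𝕊ⁿ) ↠ Γ_{n+1} ⊆ Θ_{n+1}`.

## How it is typed (tree conventions)

The tree treats gluings RELATIONALLY (`Gluing.lean`: `Literature.IsBoundaryGluing bM bN φ IP P` — "`P`
is a gluing of `M` and `N` along `φ`", with existence `exists_isBoundaryGluing` and uniqueness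
`nonempty_diffeomorph_of_isBoundaryGluing` as named facts) and provides the disc with its
boundary sphere as `Literature.closedBallBoundaryData n : BoundaryData (𝓡∂ (n+1)) 𝔻ⁿ⁺¹ (𝓡 n)`
(`ClosedBall.lean`, under the instance hypothesis `[Fact (isSmoothEmbedding_sphereInclusion' n)]`).
Accordingly:

* `Literature.IsTwistedSphere n φ P : Prop` — `P` (a charted space on `ℝⁿ⁺¹`) is the gluing
  `Dⁿ⁺¹ ∪_φ Dⁿ⁺¹`;
* `Literature.TwistedSphere n φ : Type 1` — the bundled version (a compact Hausdorff second-countable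
  smooth `(n+1)`-manifold together with a proof that it is `Dⁿ⁺¹ ∪_φ Dⁿ⁺¹`), following the
  `HomotopySphere` pattern of `HomotopySpheres.lean`; the requested "type with instances"
  `twistedSphere n φ` is any inhabitant's `carrier`, and `Nonempty (TwistedSphere n φ)` is the
  existence fact `exists_isBoundaryGluing` specialised to two discs (`nonempty_twistedSphere`).
An explicit boundary-free construction (two copies of `ℝⁿ⁺¹` glued along `x ↦ φ(x/‖x‖)/‖x‖`)
would inhabit `TwistedSphere n φ`; it is not carried out here.

## Sources

* M. Kervaire, J. Milnor, *Groups of homotopy spheres I*, Ann. Math. 77 (1963), §1.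
* J. Milnor, *Lectures on the h-cobordism theorem* (1965), §1 (gluing), §9 (twisted spheres and
  `Γₙ`); J. Cerf, *Sur les difféomorphismes de la sphère de dimension trois (Γ₄ = 0)* (1968).
* M. Hirsch, *Differential Topology* (1976), §8.2 (gluing, dependence on isotopy class).
-/

noncomputable section

open scoped Manifold ContDiff Topology
open Set Function

namespace Literature.Topology.FourManifolds

/-- Local notation for the model space `ℝⁿ`. -/
local notation "𝔼 " n:arg => EuclideanSpace ℝ (Fin n)
/-- Local notation for the unit sphere `𝕊ⁿ ⊆ ℝⁿ⁺¹`. -/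
local notation "𝕊 " n:arg => (Metric.sphere (0 : EuclideanSpace ℝ (Fin (n + 1))) 1)
/-- Local notation for the closed unit ball `𝔻ⁿ ⊆ ℝⁿ`. -/
local notation "𝔻 " n:arg => (Metric.closedBall (0 : EuclideanSpace ℝ (Fin n)) 1)

variable (n : ℕ) [Fact (isSmoothEmbedding_sphereInclusion' n)]

/-- **`IsTwistedSphere n φ P`**: the charted space `P` (modelled on `ℝⁿ⁺¹`) is the twisted sphere
`Σ(φ) = Dⁿ⁺¹ ∪_φ Dⁿ⁺¹`, i.e. the gluing of two closed `(n+1)`-discs along the diffeomorphism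
`φ : 𝕊ⁿ ≅ 𝕊ⁿ` of their boundaries (`IsBoundaryGluing` of two copies of `closedBallBoundaryData n`).
[Kervaire–Milnor 1963, §1; Milnor 1965, §9 (twisted spheres)] [cite: KervaireMilnor1963, §1] -/
def IsTwistedSphere (φ : (𝕊 n) ≃ₘ⟮𝓡 n, 𝓡 n⟯ (𝕊 n)) (P : Type*) [TopologicalSpace P]
    [ChartedSpace (𝔼 (n + 1)) P] : Prop :=
  IsBoundaryGluing (closedBallBoundaryData n) (closedBallBoundaryData n) φ (𝓡 (n + 1)) P

/-- **Twisted spheres, bundled**: a compact Hausdorff second-countable smooth `(n+1)`-manifold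
`carrier` (no boundary, model `𝓡 (n+1)`) which is the gluing `Dⁿ⁺¹ ∪_φ Dⁿ⁺¹`. Any two are
diffeomorphic (`nonempty_diffeomorph_of_isBoundaryGluing`), and one exists
(`nonempty_twistedSphere`). [Kervaire–Milnor 1963, §1; Milnor 1965, §9] [cite: KervaireMilnor1963, §1] -/
structure TwistedSphere (φ : (𝕊 n) ≃ₘ⟮𝓡 n, 𝓡 n⟯ (𝕊 n)) : Type 1 where
  /-- The underlying manifold `Σ(φ)`. -/
  carrier : Type
  /-- its topology -/
  [topologicalSpace : TopologicalSpace carrier]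
  /-- Hausdorff -/
  [t2Space : T2Space carrier]
  /-- second countable -/
  [secondCountableTopology : SecondCountableTopology carrier]
  /-- compact -/
  [compactSpace : CompactSpace carrier]
  /-- the atlas, modelled on `ℝⁿ⁺¹` -/
  [chartedSpace : ChartedSpace (𝔼 (n + 1)) carrier]
  /-- smooth -/
  [isManifold : IsManifold (𝓡 (n + 1)) ∞ carrier]
  /-- `carrier` is the gluing `Dⁿ⁺¹ ∪_φ Dⁿ⁺¹` -/
  isTwistedSphere : IsTwistedSphere n φ carrier

attribute [instance] TwistedSphere.topologicalSpace TwistedSphere.t2Space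
  TwistedSphere.secondCountableTopology TwistedSphere.compactSpace TwistedSphere.chartedSpace
  TwistedSphere.isManifold

variable {n}

/-- `𝕊ⁿ⁺¹` is the untwisted sphere `Σ(id) = Dⁿ⁺¹ ∪_{id} Dⁿ⁺¹` (the double of the disc), from
the tree's fact `isDouble_sphere`. [Milnor 1965, §9; Hirsch 1976, §8.2 Example] [folklore] -/
theorem isTwistedSphere_refl_sphere (h : isDouble_sphere n) :
    IsTwistedSphere n (Diffeomorph.refl (𝓡 n) (𝕊 n) ∞) (𝕊 (n + 1)) := by
  unfold IsTwistedSphere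
  rw [Diffeomorph.coe_refl]
  exact h

/-- Hence the round sphere inhabits `TwistedSphere n id`. [Milnor 1965, §9] [folklore] -/
def TwistedSphere.sphere (h : isDouble_sphere n) :
    TwistedSphere n (Diffeomorph.refl (𝓡 n) (𝕊 n) ∞) where
  carrier := 𝕊 (n + 1)
  isTwistedSphere := isTwistedSphere_refl_sphere h

/-- A twisted sphere is compact (both discs are). [Milnor 1965, §1] [folklore] -/
theorem IsTwistedSphere.compactSpace {φ : (𝕊 n) ≃ₘ⟮𝓡 n, 𝓡 n⟯ (𝕊 n)} {P : Type*}
    [TopologicalSpace P] [ChartedSpace (𝔼 (n + 1)) P] (h : IsTwistedSphere n φ P) :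
    CompactSpace P :=
  IsBoundaryGluing.compactSpace h

/-- **Existence of `Σ(φ)`** from the gluing existence fact of `Gluing.lean` specialised to two
discs. [Milnor 1965, §1 Thm. 1.4; Hirsch 1976, Thm. 8.2.1] [folklore] -/
theorem nonempty_twistedSphere
    (hex : exists_isBoundaryGluing (closedBallBoundaryData n) (closedBallBoundaryData n))
    (φ : (𝕊 n) ≃ₘ⟮𝓡 n, 𝓡 n⟯ (𝕊 n)) : Nonempty (TwistedSphere n φ) := by
  obtain ⟨P, _, _, _, _, _, _, hP⟩ := hex φ
  exact ⟨{ carrier := P, isTwistedSphere := hP }⟩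

/-- **Uniqueness of `Σ(φ)` up to diffeomorphism**, from the gluing uniqueness fact.
[Hirsch 1976, Thm. 8.2.1; Milnor 1965, §1] [folklore] -/
theorem TwistedSphere.nonempty_diffeomorph {φ : (𝕊 n) ≃ₘ⟮𝓡 n, 𝓡 n⟯ (𝕊 n)}
    (S T : TwistedSphere n φ)
    (huniq : nonempty_diffeomorph_of_isBoundaryGluing (bM := closedBallBoundaryData n)
      (bN := closedBallBoundaryData n) (P := S.carrier) (P' := T.carrier)) :
    Nonempty (S.carrier ≃ₘ⟮𝓡 (n + 1), 𝓡 (n + 1)⟯ T.carrier) :=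
  huniq S.isTwistedSphere T.isTwistedSphere

/-- **`Σ(φ)` depends only on the isotopy class of `φ`**, from the corresponding gluing fact.
[Hirsch 1976, Thm. 8.2.2; Milnor 1965, §9 (`Γₙ = π₀ Diff⁺(𝕊ⁿ⁻¹)/…`)] [folklore] -/
theorem TwistedSphere.nonempty_diffeomorph_of_isSmoothlyIsotopic
    {φ ψ : (𝕊 n) ≃ₘ⟮𝓡 n, 𝓡 n⟯ (𝕊 n)} (S : TwistedSphere n φ) (T : TwistedSphere n ψ)
    (hiso : nonempty_diffeomorph_of_isBoundaryGluing_of_isSmoothlyIsotopic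
      (bM := closedBallBoundaryData n) (bN := closedBallBoundaryData n)
      (P := S.carrier) (P' := T.carrier))
    (h : IsSmoothlyIsotopic (𝓡 n) (𝓡 n) ⇑φ ⇑ψ) :
    Nonempty (S.carrier ≃ₘ⟮𝓡 (n + 1), 𝓡 (n + 1)⟯ T.carrier) :=
  hiso h S.isTwistedSphere T.isTwistedSphere

end Literature.Topology.FourManifolds
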